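import Literature.Analysis.Calculus.SardPrelim
import HarnessLib

/-!
# Sard's theorem — the Fubini step of the inductive proof

Topic `Literature/Analysis/Calculus`. Milnor's **Step 1** of the proof of Sard's theorem by
induction on the dimension of the source (Milnor, *Topology from the Differentiable Viewpoint*
(1965), §3, pp. 17–18; Sard (1942), §3 and Thm. 7.1): around a critical point `x₀` of a `C^∞` map
`f : U → F` with `df(x₀) ≠ 0`, the set of critical values is null, GIVEN Sard's theorem for maps
from open subsets of spaces of dimension `dim E - 1` (all finite-dimensional targets). One chooses a
functional `π` with `π ∘ df(x₀) ≠ 0`, straightens the coordinate `π ∘ f` by a local chart `e`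
(`SardPrelim.exists_chart_fst_eq`), so that `g = Ψ ∘ f ∘ e⁻¹` maps the hyperplanes `{t} × ker`
into hyperplanes; critical points of `f` give critical points of the slice maps, whose critical
values are null by the induction hypothesis; the (σ-compact, hence measurable) set of critical
values is then null by Fubini–Tonelli, and the conclusion is transported back to the given Haar
measure `μ` by uniqueness of Haar measure.

* `surjective_of_fst_eq_of_surjective_snd` — the linear algebra of the slice argument.
* `exists_nhds_image_null_of_fderiv_ne_zero` — Step 1.

Steps 2 and 3 are in `SardSteps.lean`; the induction is assembled in `SardProofs.lean`.

## References

* J. Milnor, *Topology from the Differentiable Viewpoint* (1965), §3, Step 1. [MilnorTDV1965]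
* A. Sard, *The measure of the critical values of differentiable maps*, Bull. AMS 48 (1942),
  883–890, §3, Thm. 7.1. [Sard1942]
-/

open MeasureTheory Set Function Filter Metric
open scoped ContDiff Topology

noncomputable section

namespace Literature.Analysis.Calculus.Sard

universe u

/-! ### Step 1: critical points with nonzero derivative -/

/-- Linear algebra of Step 1: a linear map `D : ℝ × K → ℝ × K'` preserving the first coordinate
and whose restriction `u ↦ (D (0, u)).2` is surjective is itself surjective. [folklore] -/
theorem surjective_of_fst_eq_of_surjective_snd {K : Type u} [NormedAddCommGroup K]
    [NormedSpace ℝ K] {K' : Type u} [NormedAddCommGroup K'] [NormedSpace ℝ K']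
    (D : ℝ × K →L[ℝ] ℝ × K') (hD : ∀ p, (D p).1 = p.1)
    (hs : Surjective
      ((ContinuousLinearMap.snd ℝ ℝ K').comp (D.comp (ContinuousLinearMap.inr ℝ ℝ K)))) :
    Surjective D := by
  rintro ⟨a, b⟩
  obtain ⟨u, hu⟩ := hs (b - (D (a, 0)).2)
  have hu' : (D ((0 : ℝ), u)).2 = b - (D (a, 0)).2 := by simpa using hu
  refine ⟨(a, 0) + ((0 : ℝ), u), ?_⟩
  rw [map_add]
  ext
  · simp [hD]
  · simp only [Prod.snd_add]
    rw [hu']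
    abel

/-- **Milnor's Step 1.** Let `dim E = m + 1`, `μ` an additive Haar measure on `F`, and assume Sard's
theorem for `C^∞` maps from open subsets of `m`-dimensional spaces into finite-dimensional spaces.
If `f` is `C^∞` on the open set `U` and `x₀ ∈ U` has `df(x₀) ≠ 0`, then `x₀` has a neighbourhood `V`
such that `f '' (C ∩ V)` is `μ`-null, `C = {x ∈ U | df(x) not surjective}` the critical set.
(Choose a functional `π` with `π ∘ df(x₀) ≠ 0`; in a chart `e` making `π ∘ f` the first coordinate,
`g = Ψ ∘ f ∘ e⁻¹` maps hyperplanes `{t} × ker` into hyperplanes, critical points of `f` give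
critical points of the slice maps, whose critical values are null by induction; the measurable
(σ-compact) set of critical values is then null by Fubini–Tonelli, and one transports back to `μ`
by uniqueness of Haar measure.) [cite: MilnorTDV1965, §3, Step 1 (pp. 17–18)] -/
theorem exists_nhds_image_null_of_fderiv_ne_zero {E : Type u} [NormedAddCommGroup E]
    [NormedSpace ℝ E] [FiniteDimensional ℝ E] {F : Type u} [NormedAddCommGroup F]
    [NormedSpace ℝ F] [FiniteDimensional ℝ F] [MeasurableSpace F] [BorelSpace F]
    (μ : Measure F) [μ.IsAddHaarMeasure] {m : ℕ} (hE : Module.finrank ℝ E = m + 1)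
    (IH : ∀ (E' : Type u) [NormedAddCommGroup E'] [NormedSpace ℝ E'] [FiniteDimensional ℝ E'],
      Module.finrank ℝ E' = m →
      ∀ (F' : Type u) [NormedAddCommGroup F'] [NormedSpace ℝ F'] [FiniteDimensional ℝ F']
        [MeasurableSpace F'] [BorelSpace F'] (μ' : Measure F') [μ'.IsAddHaarMeasure]
        (g : E' → F') (W : Set E'), IsOpen W → ContDiffOn ℝ ∞ g W →
        μ' (g '' {y ∈ W | ¬ Surjective (fderiv ℝ g y)}) = 0)
    {f : E → F} {U : Set E} (hU : IsOpen U) (hf : ContDiffOn ℝ ∞ f U)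
    {x₀ : E} (hx₀ : x₀ ∈ U) (hA : fderiv ℝ f x₀ ≠ 0) :
    ∃ V ∈ 𝓝 x₀, μ (f '' ({x ∈ U | ¬ Surjective (fderiv ℝ f x)} ∩ V)) = 0 := by
  have hdiff : ∀ x ∈ U, DifferentiableAt ℝ f x := fun x hx =>
    (hf.differentiableOn (by simp) x hx).differentiableAt (hU.mem_nhds hx)
  -- a vector `v` and a functional `π` with `π (df(x₀) v) ≠ 0`
  obtain ⟨v, hv⟩ : ∃ v, fderiv ℝ f x₀ v ≠ 0 := by
    by_contra h
    push Not at h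
    exact hA (ContinuousLinearMap.ext fun v => by simpa using h v)
  set q : F := fderiv ℝ f x₀ v with hq
  obtain ⟨π, -, hπ⟩ := exists_dual_vector ℝ q (norm_ne_zero_iff.2 hv)
  have hπq : π q ≠ 0 := by
    rw [hπ]
    exact_mod_cast norm_ne_zero_iff.2 hv
  -- `w = π ∘ f` and its derivative `ℓ = π ∘ df(x₀) ≠ 0`
  set w : E → ℝ := fun x => π (f x) with hw_def
  have hw : ContDiffOn ℝ ∞ w U := π.contDiff.comp_contDiffOn hf
  set ℓ : E →L[ℝ] ℝ := (π : F →L[ℝ] ℝ).comp (fderiv ℝ f x₀) with hℓ_def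
  have hℓw : fderiv ℝ w x₀ = ℓ := (π.hasFDerivAt.comp x₀ (hdiff x₀ hx₀).hasFDerivAt).fderiv
  have hℓ0 : ℓ ≠ 0 := by
    intro h
    apply hπq
    have := congrArg (fun T : E →L[ℝ] ℝ => T v) h
    simpa [hℓ_def] using this
  -- source chart straightening `w`, target splitting along `π`
  obtain ⟨Φ, hΦ⟩ := exists_equiv_prod_ker_fst_eq ℓ hℓ0
  obtain ⟨e, hx₀e, heU, he, hesymm⟩ := exists_chart_fst_eq Φ hΦ hU hw hx₀ hℓw
  have hπ0 : (π : F →L[ℝ] ℝ) ≠ 0 := by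
    intro h
    apply hπq
    rw [h]
    rfl
  let KF : Submodule ℝ F := (π : F →L[ℝ] ℝ).ker
  obtain ⟨Ψ, hΨ⟩ : ∃ Ψ : F ≃L[ℝ] ℝ × KF, ∀ y, (Ψ y).1 = π y :=
    exists_equiv_prod_ker_fst_eq (π : F →L[ℝ] ℝ) hπ0
  let ν : Measure KF := Measure.addHaar
  refine ⟨e.source, e.open_source.mem_nhds hx₀e, ?_⟩
  set T : Set F := f '' ({x ∈ U | ¬ Surjective (fderiv ℝ f x)} ∩ e.source) with hT
  -- measurability of the set of critical values `T`
  have hTmeas : MeasurableSet T := by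
    have hrepr : {x ∈ U | ¬ Surjective (fderiv ℝ f x)} ∩ e.source =
        {x ∈ U ∩ e.source | fderiv ℝ f x ∈ {L : E →L[ℝ] F | ¬ Surjective L}} := by
      ext x
      simp only [mem_inter_iff, mem_setOf_eq]
      tauto
    rw [hT, hrepr]
    exact measurableSet_image_sep_preimage (hU.inter e.open_source)
      (hf.continuousOn.mono inter_subset_left)
      ((hf.continuousOn_fderiv_of_isOpen hU (by simp)).mono inter_subset_left)
      isClosed_setOf_not_surjective
  have hSmeas : MeasurableSet (Ψ '' T) :=
    Ψ.toHomeomorph.toMeasurableEquiv.measurableSet_image.2 hTmeas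
  -- the conjugated map `g` preserves the first coordinate
  set g : ℝ × ℓ.ker → ℝ × KF := fun z => Ψ (f (e.symm z)) with hg_def
  have hg : ContDiffOn ℝ ∞ g e.target :=
    Ψ.contDiff.comp_contDiffOn (hf.comp hesymm fun z hz => heU (e.map_target hz))
  have hg1 : ∀ z ∈ e.target, (g z).1 = z.1 := by
    intro z hz
    have h1 : (e (e.symm z)).1 = w (e.symm z) := by rw [he]
    rw [e.right_inv hz] at h1
    rw [h1]
    exact hΨ (f (e.symm z))
  -- every slice of `Ψ '' T` is contained in the critical values of a slice map, hence null
  have hslice : ∀ t : ℝ, ν (Prod.mk t ⁻¹' (Ψ '' T)) = 0 := by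
    intro t
    set Wt : Set ℓ.ker := {y | (t, y) ∈ e.target} with hWt_def
    have hWt : IsOpen Wt := e.open_target.preimage (Continuous.prodMk_right t)
    set gt : ℓ.ker → KF := fun y => (g (t, y)).2 with hgt_def
    have hgt : ContDiffOn ℝ ∞ gt Wt :=
      contDiff_snd.comp_contDiffOn (hg.comp (contDiff_prodMk_right t).contDiffOn fun y hy => hy)
    have hdim : Module.finrank ℝ ℓ.ker = m := by
      have := finrank_ker_add_one_eq ℓ Φ
      omega
    have hnull := IH ℓ.ker hdim KF ν gt Wt hWt hgt
    refine measure_mono_null ?_ hnull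
    rintro y' ⟨_, ⟨x, ⟨⟨hxU, hxC⟩, hxe⟩, rfl⟩, hxy⟩
    -- `hxy : Ψ (f x) = (t, y')`; let `z = e x = (t, z.2)`
    have hz_t : e x ∈ e.target := e.map_source hxe
    have hzx : e.symm (e x) = x := e.left_inv hxe
    have hz1 : (e x).1 = t := by
      rw [he x]
      change π (f x) = t
      rw [← hΨ (f x), hxy]
    have hz_eq : e x = (t, (e x).2) := Prod.ext hz1 rfl
    have hzt' : (t, (e x).2) ∈ e.target := hz_eq ▸ hz_t
    have hxz : e.symm (t, (e x).2) = x := by rw [← hz_eq]; exact hzx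
    refine ⟨(e x).2, ⟨hzt', ?_⟩, ?_⟩
    · -- the slice map is critical at `(e x).2`
      intro hsurj
      apply hxC
      have hdsymm : DifferentiableAt ℝ e.symm (t, (e x).2) :=
        (hesymm.differentiableOn (by simp) _ hzt').differentiableAt (e.open_target.mem_nhds hzt')
      have hdf : DifferentiableAt ℝ f (e.symm (t, (e x).2)) := by
        rw [hxz]
        exact hdiff x hxU
      have hdfe : DifferentiableAt ℝ (fun z => f (e.symm z)) (t, (e x).2) := hdf.comp _ hdsymm
      have hdg : DifferentiableAt ℝ g (t, (e x).2) := Ψ.differentiableAt.comp _ hdfe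
      -- `dg` preserves the first coordinate
      have hD1 : ∀ p, (fderiv ℝ g (t, (e x).2) p).1 = p.1 := by
        intro p
        have hEq : (fun z => (g z).1) =ᶠ[𝓝 (t, (e x).2)] fun z => z.1 := by
          filter_upwards [e.open_target.mem_nhds hzt'] with z hz using hg1 z hz
        have h1 : HasFDerivAt (fun z => (g z).1)
            ((ContinuousLinearMap.fst ℝ ℝ KF).comp (fderiv ℝ g (t, (e x).2))) (t, (e x).2) :=
          hdg.hasFDerivAt.fst
        have h3 := (h1.congr_of_eventuallyEq hEq.symm).unique hasFDerivAt_fst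
        have := congrArg (fun T : ℝ × ℓ.ker →L[ℝ] ℝ => T p) h3
        simpa using this
      -- `d(gt) = snd ∘ dg ∘ inr`
      have hDt : fderiv ℝ gt (e x).2 = (ContinuousLinearMap.snd ℝ ℝ KF).comp
          ((fderiv ℝ g (t, (e x).2)).comp (ContinuousLinearMap.inr ℝ ℝ ℓ.ker)) :=
        ((hdg.hasFDerivAt.comp (e x).2 (hasFDerivAt_prodMk_right t (e x).2)).snd).fderiv
      have hsurjg : Surjective (fderiv ℝ g (t, (e x).2)) :=
        surjective_of_fst_eq_of_surjective_snd _ hD1 (hDt ▸ hsurj)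
      -- `dg = Ψ ∘ df(x) ∘ d(e.symm)`, so `df(x)` is surjective
      have hchain : fderiv ℝ g (t, (e x).2) =
          (Ψ : F →L[ℝ] ℝ × KF).comp ((fderiv ℝ f x).comp (fderiv ℝ e.symm (t, (e x).2))) := by
        rw [hg_def, show (fun z => Ψ (f (e.symm z))) = Ψ ∘ (f ∘ e.symm) from rfl,
          Ψ.comp_fderiv, fderiv_comp (t, (e x).2) (g := f) (f := e.symm) hdf hdsymm, hxz]
      rw [hchain] at hsurjg
      have h1 : Surjective ((Ψ : F →L[ℝ] ℝ × KF).comp (fderiv ℝ f x)) :=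
        Surjective.of_comp (g := fderiv ℝ e.symm (t, (e x).2)) hsurjg
      have h2 := Ψ.symm.surjective.comp h1
      have heq : (Ψ.symm ∘ ((Ψ : F →L[ℝ] ℝ × KF).comp (fderiv ℝ f x)) : E → F) = fderiv ℝ f x := by
        ext1 u
        simp
      rwa [heq] at h2
    · -- and its value there is `y'`
      change (g (t, (e x).2)).2 = y'
      rw [hg_def]
      change (Ψ (f (e.symm (t, (e x).2)))).2 = y'
      rw [hxz, hxy]
  -- Fubini–Tonelli on the measurable set `Ψ '' T`, then transport back to `μ`
  have hprod : (volume.prod ν) (Ψ '' T) = 0 := by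
    rw [Measure.measure_prod_null hSmeas]
    exact Filter.Eventually.of_forall hslice
  haveI : (volume.prod ν : Measure (ℝ × KF)).IsAddHaarMeasure :=
    Measure.prod.instIsAddHaarMeasure _ _
  exact addHaar_null_of_image_equiv_null Ψ μ (volume.prod ν) hprod

end Literature.Analysis.Calculus.Sard
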